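import Literature.Geometry.Riemannian.HamiltonSurgeryProgramme
import Literature.Geometry.Riemannian.SurgicalRicciFlowTopology
import Literature.Topology.FourManifolds.ConnectedSumTube
import HarnessLib

/-!
# Hamilton's surgery programme: the shadow class is closed under connected sums

Companion ("Proofs") file of `Literature/Geometry/Riemannian/HamiltonSurgeryProgramme.lean`,
which defines *neck-surgery resolvability* `Literature.Geometry.Riemannian.IsNeckSurgeryResolvable`,
the topological shadow, in the simply connected case, of Hamilton's surgery programme
(**Hamilton 1997**, §1.1 pp. 3–4 / **Chen–Zhu 2006**, Thm. 1.1 with §5: a closed simply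
connected PIC 4-manifold is neck-surgery resolvable). That statement is the Ricci flow with
surgery itself (Hamilton 1997, §§2–5; Chen–Zhu 2006, §§2–5 on Perelman's techniques); it is not
a named fact of the tree (it is equivalent, manifold by manifold, to Cor. 1.2(a)
`hamilton_pic_sphere_four`) but is PROVED from the named fact `chenZhu_ricciFlowWithSurgery` and
Cerf's theorem in `SurgicalRicciFlowBridge.lean` (`isNeckSurgeryResolvable_of_chenZhu_of_cerf`),
on the base case supplied here. What this file adds is the purely topological half of Hamilton's remark that his
surgeries and connected sums are mutually inverse (1997, p. 4: "We can then recover the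
original manifold by starting with some collection of standard spaces and doing surgeries
replacing two `B⁴`'s with an `S³ × B¹`"):

* `Literature.Geometry.Riemannian.IsNeckSurgeryResolvable.connectedSum` (**proved**): the class
  of neck-surgery resolvable 4-manifolds is closed under Kervaire–Milnor connected sums
  (`Literature.Topology.FourManifolds.IsConnectedSum`, arbitrary discs) of Hausdorff `C^∞`
  members — by `Literature.Topology.FourManifolds.exists_neck_of_isConnectedSum`
  (`ConnectedSumTube.lean`: the tube of `M # N` is a neck with two sides whose capped sides are
  diffeomorphic to `N` and `M`) and the `surgery` constructor.
* `IsNeckSurgeryResolvable.of_isConnectedSumOf(_isHamiltonPICPiece)` (**proved**): hence every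
  iterated connected sum of Hamilton's pieces `S⁴`, `RP⁴`, `S³ × S¹`, `S³ ×~ S¹` — the class in
  the conclusion of his Main Theorem 1.1 (p. 2) and of Chen–Zhu's Thm. 1.1 (iv), with **no
  hypothesis on `π₁`** — is resolvable; and every component of a "finite union of pieces"
  (`IsUnionOfPieces`, `SurgicalRicciFlow.lean`) is resolvable.
* `ChenZhuResolvableIn.isNeckSurgeryResolvable_zero` (**proved**): Chen–Zhu's Thm. 1.1 with no
  surgery (`ChenZhuResolvableIn 0 M g₀`) gives the shadow for connected `M`, again without `π₁`
  (the tree's `ChenZhuResolvableIn.isConnectedSumOfSpheres_zero`, `SurgicalRicciFlowTopology.lean`,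
  needed `π₁ = 1` to conclude `M ≅ S⁴`).

**How the vended analysis gives resolvability.** The named fact
`chenZhu_ricciFlowWithSurgery` (`SurgicalRicciFlow.lean`, Chen–Zhu Thm. 1.1 as the structure
`∃ m, ChenZhuResolvableIn m M g₀`) gives the shadow by induction on `m`, whose base case is the
`π₁`-free `isNeckSurgeryResolvable_zero` below (the later stages `M_k` of the flow are not
recorded as simply connected, so the induction is over the simply connected components of each
stage). The inductive step — rebuilding the components of `M_k` from those of `M_{k+1}` and the
discarded pieces along the neck pieces of the surgery step `IsSurgeryStep` — is
`forall_component_isNeckSurgeryResolvable_of_chenZhuResolvableIn` (`SurgicalRicciFlowBridge.lean`):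
as explained in the module docstring of `SurgicalRicciFlowTopology.lean`, the vended step matches
the collars only up to `Diff(S³)`, which is where Cerf's `Γ₄ = 0`
(`Literature.Topology.FourManifolds.cerf_pi0Diff_sphere_three`) enters.

## References

* R. S. Hamilton, *Four-manifolds with positive isotropic curvature*, Comm. Anal. Geom. 5 (1997)
  1–92: Thm. 1.1 (p. 2), §1.1 pp. 3–4. [Hamilton1997]
* B.-L. Chen, X.-P. Zhu, *Ricci flow with surgery on four-manifolds with positive isotropic
  curvature*, J. Differential Geom. 74 (2006) 177–264 (arXiv:math/0504478): Thm. 1.1 (p. 3),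
  §5. [ChenZhu2006]
* A. Kosinski, *Differential Manifolds* (1993), Ch. VI §1 (p. 90, Prop. 1.3). [Kosinski1993]
-/

noncomputable section

open scoped Manifold ContDiff
open Set Function

namespace Literature.Geometry.Riemannian

open Literature.Topology.FourManifolds

/-- **The class of neck-surgery resolvable 4-manifolds is closed under connected sums**
(Hamilton 1997, §1.1 p. 4: "We can then recover the original manifold by starting with some
collection of standard spaces and doing surgeries replacing two `B⁴`'s with an `S³ × B¹`",
i.e. by connected sums; Kosinski VI §1 Prop. 1.3, "joining two manifolds by a tube"). If `P`
is a connected sum `M # N` (`IsConnectedSum`, Kervaire–Milnor's relation along arbitrary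
discs) of resolvable Hausdorff `C^∞` 4-manifolds `M`, `N`, then `P` is resolvable: by
`Literature.Topology.FourManifolds.exists_neck_of_isConnectedSum` the tube of the connected sum
is a neck `ψ : S³ × ℝ ↪ P` with two sides whose capped sides are diffeomorphic to `N` and `M`,
so the `surgery` constructor applies (with `of_diffeomorph`).
[cite: Hamilton1997, §1.1 pp. 3–4] [cite: Kosinski1993, Ch. VI §1 (p. 90; Prop. 1.3)] -/
theorem IsNeckSurgeryResolvable.connectedSum {M N P : Type}
    [TopologicalSpace M] [T2Space M] [ChartedSpace (EuclideanSpace ℝ (Fin 4)) M] [IsManifold (𝓡 4) ∞ M]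
    [TopologicalSpace N] [T2Space N] [ChartedSpace (EuclideanSpace ℝ (Fin 4)) N] [IsManifold (𝓡 4) ∞ N]
    [TopologicalSpace P] [T2Space P] [ChartedSpace (EuclideanSpace ℝ (Fin 4)) P] [IsManifold (𝓡 4) ∞ P]
    (hM : IsNeckSurgeryResolvable M) (hN : IsNeckSurgeryResolvable N)
    (h : IsConnectedSum (𝓡 4) (𝓡 4) (𝓡 4) M N P) : IsNeckSurgeryResolvable P := by
  haveI := fact_finrank_euclideanSpace_succ 3
  obtain ⟨ψ, D₁, D₂, hdisj, hcover, ⟨eN⟩, ⟨eM⟩⟩ :=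
    exists_neck_of_isConnectedSum (E := EuclideanSpace ℝ (Fin 4)) (n := 3) h
  exact .surgery D₁ D₂ hdisj hcover (hN.of_diffeomorph eN) (hM.of_diffeomorph eM)

/-- **Iterated connected sums of resolvable pieces are resolvable**: induction over the closure
`IsConnectedSumOf 4 pieces` (`ConnectedSumClosure.lean`) of a class of pieces under connected
sums, each Hausdorff `C^∞` piece being resolvable. [cite: Hamilton1997, §1.1 pp. 3–4] -/
theorem IsNeckSurgeryResolvable.of_isConnectedSumOf
    {pieces : ∀ (X : Type) [TopologicalSpace X] [ChartedSpace (EuclideanSpace ℝ (Fin 4)) X], Prop}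
    (hpieces : ∀ (X : Type) [TopologicalSpace X] [ChartedSpace (EuclideanSpace ℝ (Fin 4)) X],
      pieces X → T2Space X → IsManifold (𝓡 4) ∞ X → IsNeckSurgeryResolvable X)
    {P : Type} [TopologicalSpace P] [ChartedSpace (EuclideanSpace ℝ (Fin 4)) P]
    (h : IsConnectedSumOf 4 pieces P) :
    ∀ [T2Space P] [IsManifold (𝓡 4) ∞ P], IsNeckSurgeryResolvable P := by
  induction h with
  | piece hP => exact hpieces _ hP ‹_› ‹_›
  | connectedSum hM hN hcs ihM ihN => exact ihM.connectedSum ihN hcs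

/-- **Iterated connected sums of Hamilton's pieces `S⁴`, `RP⁴`, `S³ × S¹`, `S³ ×~ S¹` are
neck-surgery resolvable** — the class appearing in Hamilton's Main Theorem 1.1 (1997, p. 2:
"diffeomorphic to `S⁴`, `RP⁴`, `S³ × S¹`, `S³ ×~ S¹`, or a connected sum of the above") and in
Chen–Zhu's Thm. 1.1 (iv) (`IsUnionOfPieces`, `SurgicalRicciFlow.lean`), with no hypothesis on
`π₁`. [cite: Hamilton1997, Thm. 1.1 (p. 2) with §1.1 pp. 3–4] -/
theorem IsNeckSurgeryResolvable.of_isConnectedSumOf_isHamiltonPICPiece {P : Type}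
    [TopologicalSpace P] [ChartedSpace (EuclideanSpace ℝ (Fin 4)) P] [T2Space P] [IsManifold (𝓡 4) ∞ P]
    (h : IsConnectedSumOf 4 IsHamiltonPICPiece P) : IsNeckSurgeryResolvable P :=
  IsNeckSurgeryResolvable.of_isConnectedSumOf (fun _ _ _ hX _ _ => .piece hX) h

/-- **An open submanifold with full carrier is resolvable iff the manifold is**: transport along
the re-typing diffeomorphism `M ≅ U` (`nonempty_diffeomorph_opens_of_coe_eq_univ`,
`SurgicalRicciFlowTopology.lean`). Used to pass between a connected manifold and its unique
component. [folklore] -/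
theorem IsNeckSurgeryResolvable.of_opens_coe_eq_univ {M : Type} [TopologicalSpace M]
    [ChartedSpace (EuclideanSpace ℝ (Fin 4)) M] [IsManifold (𝓡 4) ∞ M] (U : TopologicalSpace.Opens M)
    (hU : (U : Set M) = univ) (h : IsNeckSurgeryResolvable U) : IsNeckSurgeryResolvable M := by
  obtain ⟨e⟩ := nonempty_diffeomorph_opens_of_coe_eq_univ (I := 𝓡 4) U hU
  exact h.of_diffeomorph e.symm

/-- Conversely, the full open submanifold of a resolvable manifold is resolvable. [folklore] -/
theorem IsNeckSurgeryResolvable.opens_of_coe_eq_univ {M : Type} [TopologicalSpace M]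
    [ChartedSpace (EuclideanSpace ℝ (Fin 4)) M] [IsManifold (𝓡 4) ∞ M] (U : TopologicalSpace.Opens M)
    (hU : (U : Set M) = univ) (h : IsNeckSurgeryResolvable M) : IsNeckSurgeryResolvable U := by
  obtain ⟨e⟩ := nonempty_diffeomorph_opens_of_coe_eq_univ (I := 𝓡 4) U hU
  exact h.of_diffeomorph e

/-- **A connected "finite union of pieces" is resolvable** (Chen–Zhu 2006, Thm. 1.1 (iv) for a
connected `M_m`, no hypothesis on `π₁`): `IsUnionOfPieces.isConnectedSumOf`
(`SurgicalRicciFlowTopology.lean`) and `of_isConnectedSumOf_isHamiltonPICPiece`.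
[cite: ChenZhu2006, Thm. 1.1 (iv) (p. 3)] -/
theorem IsUnionOfPieces.isNeckSurgeryResolvable {M : Type} [TopologicalSpace M] [T2Space M]
    [ChartedSpace (EuclideanSpace ℝ (Fin 4)) M] [IsManifold (𝓡 4) ∞ M] [ConnectedSpace M] (h : IsUnionOfPieces M) :
    IsNeckSurgeryResolvable M :=
  .of_isConnectedSumOf_isHamiltonPICPiece h.isConnectedSumOf

/-- **Every component of a "finite union of pieces" is resolvable** (Chen–Zhu 2006, Thm. 1.1
(iv), rendered as `IsUnionOfPieces`: the component of every point is an open submanifold in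
the closure of Hamilton's pieces under connected sums). [cite: ChenZhu2006, Thm. 1.1 (iv) (p. 3)] -/
theorem IsUnionOfPieces.exists_isNeckSurgeryResolvable_component {M : Type} [TopologicalSpace M]
    [T2Space M] [ChartedSpace (EuclideanSpace ℝ (Fin 4)) M] [IsManifold (𝓡 4) ∞ M] (h : IsUnionOfPieces M) (x : M) :
    ∃ C : TopologicalSpace.Opens M, (C : Set M) = connectedComponent x ∧
      IsNeckSurgeryResolvable C := by
  obtain ⟨C, hC, hsum⟩ := h.2 x
  exact ⟨C, hC, .of_isConnectedSumOf_isHamiltonPICPiece hsum⟩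

/-- **Chen–Zhu's Thm. 1.1 with no surgery implies the shadow**, for connected `M` and without
any hypothesis on `π₁`: if the Ricci flow resolves the closed 4-manifold `(M, g₀)` with `m = 0`
surgeries (`ChenZhuResolvableIn 0 M g₀`, `SurgicalRicciFlow.lean`: the maximal flow exists and
`M` is already a finite union of pieces), then `M` is neck-surgery resolvable
(`IsUnionOfPieces.isConnectedSumOf`, `SurgicalRicciFlowTopology.lean`, and
`IsNeckSurgeryResolvable.of_isConnectedSumOf_isHamiltonPICPiece`). The case `m ≥ 1` is the
inductive surgery step discussed in the module docstring of `SurgicalRicciFlowTopology.lean`.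
[cite: ChenZhu2006, Thm. 1.1 (p. 3)] [cite: Hamilton1997, §1.1 pp. 3–4] -/
theorem ChenZhuResolvableIn.isNeckSurgeryResolvable_zero {M : Type} [TopologicalSpace M]
    [T2Space M] [SecondCountableTopology M] [CompactSpace M] [ChartedSpace (EuclideanSpace ℝ (Fin 4)) M]
    [IsManifold (𝓡 4) ∞ M] [ConnectedSpace M]
    {g₀ : Lorentzian.PseudoRiemannianMetric (𝓡 4) ∞ (EuclideanSpace ℝ (Fin 4)) (TangentSpace (𝓡 4) : M → Type _)}
    (h : ChenZhuResolvableIn 0 M g₀) : IsNeckSurgeryResolvable M := by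
  obtain ⟨-, -, -, -, -, hpieces⟩ := h
  exact hpieces.isNeckSurgeryResolvable

/-- **The surgery shadow from Chen–Zhu's Thm. 1.1 in the case of no surgery**: if the flow of
Thm. 1.1 from a PIC metric on the closed simply connected `M` has `m = 0`
(`ChenZhuResolvableIn 0 M g`), then `M` is neck-surgery resolvable.
[cite: ChenZhu2006, Thm. 1.1 (p. 3)] [cite: Hamilton1997, §1.1 pp. 3–4] -/
theorem isNeckSurgeryResolvable_of_chenZhuResolvableIn_zero {M : Type} [TopologicalSpace M]
    [T2Space M] [SecondCountableTopology M] [ChartedSpace (EuclideanSpace ℝ (Fin 4)) M] [IsManifold (𝓡 4) ∞ M]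
    [CompactSpace M] [SimplyConnectedSpace M]
    {g : Lorentzian.PseudoRiemannianMetric (𝓡 4) ∞ (EuclideanSpace ℝ (Fin 4)) (TangentSpace (𝓡 4) : M → Type _)}
    (h : ChenZhuResolvableIn 0 M g) : IsNeckSurgeryResolvable M := by
  haveI : PathConnectedSpace M := inferInstance
  exact h.isNeckSurgeryResolvable_zero

end Literature.Geometry.Riemannian

end
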